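import Mathlib.NumberTheory.LSeries.DirichletContinuation
import Mathlib.NumberTheory.LSeries.RiemannZeta
import Mathlib.NumberTheory.DirichletCharacter.Orthogonality
import Mathlib.Analysis.SpecialFunctions.Gamma.Basic
import HarnessLib

/-!
# The twisted second moment of Dirichlet `L`-functions to a prime modulus beyond the
# `1/2`-barrier (Bui–Pratt–Robles–Zaharescu 2020, Theorems 1.1 and 1.2)

Topic `Literature/NumberTheory/LFunctions` (namespace `Literature.NumberTheory.LFunctions`).
STATEMENT LAYER (D-0014: sorry-free named `Prop` facts, nothing asserted) typed for the repair rung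
F-S1R of the cell `siegel-zhang` (HOME/repair/ESTAR.md row E1 / E*-len, LEVERS.md L10): the ONLY
printed asymptotic evaluation, WITH main terms, of a mollifier-type ("twisted") moment for a family
of Dirichlet characters to ONE PRIME modulus in which the twisting Dirichlet polynomial is LONGER
than the square root of the conductor (`κ > 1/2`, the "`1/2`-barrier" of Iwaniec–Sarnak 1999).
It is the yardstick against which that rung prices a hypothetical estimate `E*-len`; it is a
theorem in print, typed here as a named fact, not a conjecture and not a claim about the
manuscript adjudicated by that cell.

## What the source prints (arXiv TeX source of the published version, read 2026-08-26)

H. M. Bui, K. Pratt, N. Robles, A. Zaharescu, *Breaking the `1/2`-barrier for the twisted second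
moment of Dirichlet `L`-functions*, Adv. Math. **370** (2020) 107175 = arXiv:1808.10803.
Setting (§1, p. 2): `q` prime; `α, β ∈ ℂ` with `Re(α), Re(β) ≪ (log q)⁻¹`, `Im(α), Im(β) ≪ log q`;
`φ⁺(q)` = the number of EVEN primitive characters mod `q` (`= (q − 3)/2`), `Σ⁺` = sum over them
("our arguments go through identically for odd characters"); for fixed `0 < κ < 1`,
`I_{α,β} = (1/φ⁺(q)) Σ⁺_{χ (mod q)} L(1/2 + α, χ) L(1/2 + β, χ̄) |A(χ)|²`,
`A(χ) = Σ_{a ≤ q^κ} α_a χ(a)/√a`, "`α_a` is an arbitrary sequence of complex numbers satisfying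
`α_a ≪_ε a^ε`"; "Throughout the paper `ε` denotes an arbitrarily small positive number".

* **Theorem 1.1.** "Suppose that `q` is prime. Let `α, β ∈ ℂ` satisfy
  `|Re(α)|, |Re(β)| ≪ (log q)⁻¹` and `|Im(α)|, |Im(β)| ≪ log q`. Suppose that `κ < 1/2 + 1/202`.
  Then
  `I_{α,β} = ζ(1+α+β) Σ_{da,db ≤ q^κ, (a,b)=1} α_{da} conj(α_{db}) / (d a^{1+β} b^{1+α})`
  `  + (q/π)^{−(α+β)} · Γ((1/2−α)/2) Γ((1/2−β)/2) / (Γ((1/2+α)/2) Γ((1/2+β)/2)) · ζ(1−α−β)`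
  `      · Σ_{da,db ≤ q^κ, (a,b)=1} α_{da} conj(α_{db}) / (d a^{1−α} b^{1−β}) + O(q^{−δ₀})`   (1.2)
  for some `δ₀ > 0`." Followed by: "The use of Theorem 2 of [Duke–Friedlander–Iwaniec,
  *Bilinear forms with Kloosterman fractions*, Invent. Math. 128 (1997)] and our Proposition 3.2
  below also suffices to break the `1/2`-barrier. With those results, Theorem 1.1 holds provided
  that `κ < 1/2 + 1/526`." (The `1/202` itself rests on Bettin–Chandee 2018, Theorem 1 — §3 of the
  source: "The above expression is in the form of Theorem 1 of [BC]". Both Kloosterman-fraction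
  inputs are in the tree: `Literature.NumberTheory.LFunctions.BettinChandee2018_trilinearKloostermanFractions`,
  `…DukeFriedlanderIwaniec1997_bilinearKloostermanFractions`.)
* **Theorem 1.2.** With `α = η ∗ λ` (Dirichlet convolution), `η`, `λ` supported on `[1, A₁]`,
  `[1, A₂]`, `A₁ = q^{κ₁}`, `A₂ = q^{κ₂}`, `κ = κ₁ + κ₂`, `η_a, λ_a ≪ a^ε`: "Assume as above and
  suppose further that `9κ + max{κ₁, κ₂} < 5`. Then (1.2) holds for some `δ₀ > 0`."
  "If `κ₁ = κ₂`, then Theorem 1.2 allows us to take `κ < 1/2 + 1/38`."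
  (Theorem 1.3, the smooth-times-arbitrary case with `ϑ = 7/64`, and Theorem 1.4, the third
  moment `≍ (log q)^{9/4}`, are not typed.)

## Lean rendering / design choices

* `q` prime with `[NeZero q]` (needed by `DirichletCharacter.LFunction`); "even primitive
  characters mod `q`" = `χ.IsPrimitive ∧ χ.Even` (Mathlib); `φ⁺(q)` = the cardinality of that
  finset (for `q` prime it is `(q−3)/2`; we do not hard-code it). `L(s, χ̄)`: the complex-conjugate
  character of a Dirichlet character is its group inverse, so `L(1/2+β, χ̄) = χ⁻¹.LFunction (1/2+β)`.
  `|A(χ)|²` is the real square of the norm, cast to `ℂ`.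
* "`a ≤ q^κ`" = `1 ≤ a ≤ ⌊q^κ⌋₊`; the main-term double sums run over `d, a, b ≥ 1` with
  `d a ≤ q^κ`, `d b ≤ q^κ`, `gcd(a,b) = 1` (the printed `Σ_{da,db ≤ q^κ, (a,b)=1}`), with complex
  powers `(a : ℂ) ^ (1 + β)` etc. of positive integers.
* The `≪`-conventions are rendered exactly as in `Literature.Barriers.RiemannHypothesis.Radziwill2012_thm1`:
  the box constants `C₁, C₂` (for `Re`, `Im` of the shifts) and a growth budget `C : ℝ → ℝ`
  (`ε ↦ C_ε`, `|α_a| ≤ C_ε a^ε` for every `ε > 0`) are fixed FIRST; then `δ₀ > 0`, the `O`-constant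
  `K` and the threshold `q₀` may depend on `κ, C₁, C₂, C` (and on `κ₁, κ₂` in Theorem 1.2) — the
  uniformity the printed proof delivers and the one the applications (mollifiers depending on `q`
  with divisor-bounded coefficients) use.
* (1.2) has removable singularities on `α + β = 0` (poles of `ζ(1 ± (α+β))` cancelling); since
  Mathlib's `riemannZeta 1` is a finite junk value, the fact is stated for `α + β ≠ 0`, where (1.2)
  is literally meaningful; the printed statement on the line `α + β = 0` is the limit of these.

PROVED here (bookkeeping only): `BPRZ2020.kappa_thm11_eq` (`1/2 + 1/202 = 51/101`, the abstract's
`q^{51/101}`), `BPRZ2020.kappa_thm12_symmetric` (for `κ₁ = κ₂ = κ/2` the condition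
`9κ + max{κ₁,κ₂} < 5` is `κ < 10/19 = 1/2 + 1/38`), and `BPRZ2020.twistedMoment_def`/`mainTerm_def`
style unfolding is by `rfl`. Nothing else is claimed. WHAT THIS IS NOT: not a statement about
Zhang's manuscript arXiv:2211.02515 or about Siegel zeros; not the (open) prime-modulus analogue
for the degree-three objects of that manuscript.

## References

* [BuiPrattRoblesZaharescu2020] Theorems 1.1, 1.2 (eq. (1.2)); remarks after Theorem 1.1 and
  Theorem 1.2; §1 setting; the `ε`-convention (end of §1).
* [BettinChandee2018] Theorem 1; [DukeFriedlanderIwaniec1997] Theorem 2 (inputs, typed elsewhere).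
-/

noncomputable section

open Finset

namespace Literature.NumberTheory.LFunctions

namespace BPRZ2020

/-- The length `⌊q^κ⌋` of the twisting polynomial ("`a ≤ q^κ`").
[cite: BuiPrattRoblesZaharescu2020, §1] -/
def twistLength (q : ℕ) (κ : ℝ) : ℕ := ⌊(q : ℝ) ^ κ⌋₊

/-- The twisting Dirichlet polynomial `A(χ) = Σ_{a ≤ q^κ} α_a χ(a) / √a` of
Bui–Pratt–Robles–Zaharescu (coefficients `coef = (α_a)`, evaluated at the character `χ` mod `q`).
[cite: BuiPrattRoblesZaharescu2020, §1] -/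
def twist (q : ℕ) (κ : ℝ) (coef : ℕ → ℂ) (χ : DirichletCharacter ℂ q) : ℂ :=
  ∑ a ∈ Icc 1 (twistLength q κ), coef a * χ (a : ZMod q) / ((Real.sqrt a : ℝ) : ℂ)

open scoped Classical in
/-- `φ⁺(q)`: the number of even primitive Dirichlet characters mod `q` (`= (q−3)/2` for `q` prime).
[cite: BuiPrattRoblesZaharescu2020, §1] -/
def evenPrimitiveCount (q : ℕ) : ℕ :=
  (univ.filter fun χ : DirichletCharacter ℂ q => χ.IsPrimitive ∧ χ.Even).card

open scoped Classical in
/-- The twisted second moment over even primitive characters mod `q` with shifts `α, β`: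
`I_{α,β} = (1/φ⁺(q)) Σ⁺_{χ (mod q)} L(1/2+α, χ) L(1/2+β, χ̄) |A(χ)|²`
(`χ̄ = χ⁻¹`; `L` = Mathlib's completed-to-entire `DirichletCharacter.LFunction`).
[cite: BuiPrattRoblesZaharescu2020, §1] -/
def twistedMoment (q : ℕ) [NeZero q] (κ : ℝ) (coef : ℕ → ℂ) (α β : ℂ) : ℂ :=
  (∑ χ : DirichletCharacter ℂ q with (χ.IsPrimitive ∧ χ.Even),
      χ.LFunction (1 / 2 + α) * (χ⁻¹).LFunction (1 / 2 + β) *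
        (((‖twist q κ coef χ‖ ^ 2 : ℝ)) : ℂ)) /
    (evenPrimitiveCount q : ℂ)

/-- The arithmetic double sum of the main terms of (1.2):
`Σ_{d,a,b ≥ 1; da, db ≤ L; (a,b)=1} α_{da} conj(α_{db}) / (d · a^u · b^v)`
(`u = 1+β, v = 1+α` in the first main term, `u = 1−α, v = 1−β` in the second).
[cite: BuiPrattRoblesZaharescu2020, Theorem 1.1 (1.2)] -/
def coprimeDiagonalSum (L : ℕ) (coef : ℕ → ℂ) (u v : ℂ) : ℂ :=
  ∑ d ∈ Icc 1 L, ∑ a ∈ Icc 1 L, ∑ b ∈ Icc 1 L,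
    if d * a ≤ L ∧ d * b ≤ L ∧ Nat.Coprime a b then
      coef (d * a) * (starRingEnd ℂ) (coef (d * b)) / ((d : ℂ) * (a : ℂ) ^ u * (b : ℂ) ^ v)
    else 0

/-- The ratio of Gamma factors in the second main term of (1.2):
`Γ((1/2−α)/2) Γ((1/2−β)/2) / (Γ((1/2+α)/2) Γ((1/2+β)/2))`.
[cite: BuiPrattRoblesZaharescu2020, Theorem 1.1 (1.2)] -/
def gammaRatio (α β : ℂ) : ℂ :=
  Complex.Gamma ((1 / 2 - α) / 2) * Complex.Gamma ((1 / 2 - β) / 2) /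
    (Complex.Gamma ((1 / 2 + α) / 2) * Complex.Gamma ((1 / 2 + β) / 2))

/-- The main term of (1.2) (diagonal term + "root-number"/off-diagonal-completed term):
`ζ(1+α+β) Σ_{(a,b)=1} α_{da}conj(α_{db})/(d a^{1+β} b^{1+α})`
`+ (q/π)^{−(α+β)} · gammaRatio α β · ζ(1−α−β) · Σ_{(a,b)=1} α_{da}conj(α_{db})/(d a^{1−α} b^{1−β})`.
[cite: BuiPrattRoblesZaharescu2020, Theorem 1.1 (1.2)] -/
def mainTerm (q : ℕ) (κ : ℝ) (coef : ℕ → ℂ) (α β : ℂ) : ℂ :=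
  riemannZeta (1 + α + β) * coprimeDiagonalSum (twistLength q κ) coef (1 + β) (1 + α) +
    ((q : ℂ) / (Real.pi : ℂ)) ^ (-(α + β)) * gammaRatio α β * riemannZeta (1 - α - β) *
      coprimeDiagonalSum (twistLength q κ) coef (1 - α) (1 - β)

/-- The coefficient-growth hypothesis "`α_a ≪_ε a^ε` for every `ε > 0`" with a growth budget
`C : ℝ → ℝ` fixed in advance (`|α_a| ≤ C(ε) · a^ε` for all `ε > 0`, `a ≥ 1`), as in
`Literature.Barriers.RiemannHypothesis.Radziwill2012_thm1`.
[cite: BuiPrattRoblesZaharescu2020, §1] -/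
def DivisorBounded (C : ℝ → ℝ) (coef : ℕ → ℂ) : Prop :=
  ∀ ε : ℝ, 0 < ε → ∀ a : ℕ, 1 ≤ a → ‖coef a‖ ≤ C ε * (a : ℝ) ^ ε

/-- The shift box "`|Re(α)|, |Re(β)| ≪ (log q)⁻¹` and `|Im(α)|, |Im(β)| ≪ log q`" with implied
constants `C₁, C₂`. [cite: BuiPrattRoblesZaharescu2020, Theorem 1.1] -/
def InShiftBox (C₁ C₂ : ℝ) (q : ℕ) (α β : ℂ) : Prop :=
  |α.re| ≤ C₁ / Real.log q ∧ |β.re| ≤ C₁ / Real.log q ∧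
    |α.im| ≤ C₂ * Real.log q ∧ |β.im| ≤ C₂ * Real.log q

/-- The asymptotic (1.2) with a power saving, for the modulus `q`, length exponent `κ`, shift-box
constants `C₁, C₂`, growth budget `C` and a class of admissible coefficient sequences `Adm`
(all sequences for Theorem 1.1; the factorable ones for Theorem 1.2): there are `δ₀ > 0`, `K`, `q₀`
such that for every prime `q ≥ q₀`, every admissible `(α_a)` with `|α_a| ≤ C(ε)a^ε`, and all shifts
in the box with `α + β ≠ 0`, `|I_{α,β} − mainTerm| ≤ K q^{−δ₀}`.
[cite: BuiPrattRoblesZaharescu2020, Theorem 1.1 (1.2)] -/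
def AsymptoticHolds (κ C₁ C₂ : ℝ) (C : ℝ → ℝ) (Adm : ℕ → (ℕ → ℂ) → Prop) : Prop :=
  ∃ δ₀ : ℝ, 0 < δ₀ ∧ ∃ K : ℝ, ∃ q₀ : ℕ,
    ∀ (q : ℕ) [NeZero q], q.Prime → q₀ ≤ q →
      ∀ coef : ℕ → ℂ, Adm q coef → DivisorBounded C coef →
        ∀ α β : ℂ, InShiftBox C₁ C₂ q α β → α + β ≠ 0 →
          ‖twistedMoment q κ coef α β - mainTerm q κ coef α β‖ ≤ K * (q : ℝ) ^ (-δ₀)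

/-- Factorable coefficients of Theorem 1.2: `α = η ∗ λ` (Dirichlet convolution) with `η`
supported on `[1, q^{κ₁}]`, `λ` on `[1, q^{κ₂}]`, both `≪ a^ε` with budget `C`.
[cite: BuiPrattRoblesZaharescu2020, Theorem 1.2] -/
def Factorable (κ₁ κ₂ : ℝ) (C : ℝ → ℝ) (q : ℕ) (coef : ℕ → ℂ) : Prop :=
  ∃ η lam : ℕ → ℂ, DivisorBounded C η ∧ DivisorBounded C lam ∧
    (∀ a : ℕ, (q : ℝ) ^ κ₁ < a → η a = 0) ∧ (∀ a : ℕ, (q : ℝ) ^ κ₂ < a → lam a = 0) ∧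
      ∀ n : ℕ, coef n = ∑ x ∈ n.divisorsAntidiagonal, η x.1 * lam x.2

end BPRZ2020

open BPRZ2020

/-! ### The named facts -/

/-- **Bui–Pratt–Robles–Zaharescu 2020, Theorem 1.1** (the twisted second moment of Dirichlet
`L`-functions to a PRIME modulus `q`, twisted by `|A(χ)|²` with an ARBITRARY Dirichlet polynomial
`A(χ) = Σ_{a ≤ q^κ} α_a χ(a)/√a`, `α_a ≪_ε a^ε`, has the asymptotic (1.2) — diagonal main term
`ζ(1+α+β)Σ…` plus the dual main term `(q/π)^{−(α+β)}·(Γ-ratio)·ζ(1−α−β)Σ…` — with an error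
`O(q^{−δ₀})`, `δ₀ > 0`, for every `κ < 1/2 + 1/202`, uniformly for shifts
`|Re α|, |Re β| ≪ 1/log q`, `|Im α|, |Im β| ≪ log q`). Quantifier rendering and the restriction
`α + β ≠ 0` (removable singularity of (1.2)) as explained in the module docstring; even primitive
characters as printed ("identically for odd characters"). NAMED FACT, not proved here.
[cite: BuiPrattRoblesZaharescu2020, Theorem 1.1] -/
def buiPrattRoblesZaharescu2020_theorem11 : Prop :=
  ∀ κ : ℝ, 0 < κ → κ < 1 / 2 + 1 / 202 →
    ∀ C₁ C₂ : ℝ, ∀ C : ℝ → ℝ,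
      AsymptoticHolds κ C₁ C₂ C (fun _ _ => True)

/-- **Bui–Pratt–Robles–Zaharescu 2020, Theorem 1.2** (factorable coefficients go further): with
`α = η ∗ λ`, `η` supported on `[1, q^{κ₁}]`, `λ` on `[1, q^{κ₂}]`, `κ = κ₁ + κ₂`,
`η_a, λ_a ≪ a^ε`: "Assume as above and suppose further that `9κ + max{κ₁, κ₂} < 5`. Then (1.2)
holds for some `δ₀ > 0`." NAMED FACT, not proved here.
[cite: BuiPrattRoblesZaharescu2020, Theorem 1.2] -/
def buiPrattRoblesZaharescu2020_theorem12 : Prop :=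
  ∀ κ₁ κ₂ : ℝ, 0 < κ₁ → 0 < κ₂ → 9 * (κ₁ + κ₂) + max κ₁ κ₂ < 5 →
    ∀ C₁ C₂ : ℝ, ∀ C : ℝ → ℝ,
      AsymptoticHolds (κ₁ + κ₂) C₁ C₂ C (Factorable κ₁ κ₂ C)

/-! ### Bookkeeping (proved) -/

/-- The abstract's exponent: `1/2 + 1/202 = 51/101` ("less than `q^{51/101} = q^{1/2+1/202}`").
[cite: BuiPrattRoblesZaharescu2020, Abstract] -/
theorem BPRZ2020.kappa_thm11_eq : (1 : ℝ) / 2 + 1 / 202 = 51 / 101 := by norm_num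

/-- "If `κ₁ = κ₂`, then Theorem 1.2 allows us to take `κ < 1/2 + 1/38`": with `κ₁ = κ₂ = κ/2` the
condition `9κ + max{κ₁, κ₂} < 5` reads `κ < 10/19 = 1/2 + 1/38`.
[cite: BuiPrattRoblesZaharescu2020, remark after Theorem 1.2] -/
theorem BPRZ2020.kappa_thm12_symmetric (κ : ℝ) :
    9 * (κ / 2 + κ / 2) + max (κ / 2) (κ / 2) < 5 ↔ κ < 1 / 2 + 1 / 38 := by
  rw [max_self]
  constructor <;> intro h <;> linarith

/-- Theorem 1.2 applies to the symmetric factorable case for every `κ < 1/2 + 1/38`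
(a direct specialisation of the named fact; the printed "`κ < 1/2 + 1/38`").
[cite: BuiPrattRoblesZaharescu2020, remark after Theorem 1.2] -/
theorem buiPrattRoblesZaharescu2020_theorem12.symmetric (h : buiPrattRoblesZaharescu2020_theorem12)
    {κ : ℝ} (hκ : 0 < κ) (hκ' : κ < 1 / 2 + 1 / 38) (C₁ C₂ : ℝ) (C : ℝ → ℝ) :
    AsymptoticHolds (κ / 2 + κ / 2) C₁ C₂ C (Factorable (κ / 2) (κ / 2) C) :=
  h (κ / 2) (κ / 2) (by linarith) (by linarith) ((BPRZ2020.kappa_thm12_symmetric κ).2 hκ') C₁ C₂ C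

/-- Theorem 1.1 covers lengths beyond the square root of the conductor: every
`κ ∈ (1/2, 51/101)` is admissible (the "`1/2`-barrier" is broken by `1/202`).
[cite: BuiPrattRoblesZaharescu2020, Theorem 1.1] -/
theorem buiPrattRoblesZaharescu2020_theorem11.beyond_half (h : buiPrattRoblesZaharescu2020_theorem11)
    {κ : ℝ} (hκ : 1 / 2 < κ) (hκ' : κ < 51 / 101) (C₁ C₂ : ℝ) (C : ℝ → ℝ) :
    AsymptoticHolds κ C₁ C₂ C (fun _ _ => True) :=
  h κ (by linarith) (by rw [BPRZ2020.kappa_thm11_eq]; exact hκ') C₁ C₂ C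

end Literature.NumberTheory.LFunctions
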